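import Literature.AlgebraicGeometry.HodgeTheory.QuaternionicQuarticDeckChartAction
import Literature.AlgebraicGeometry.Resolution.PolynomialQuotientBaseChange
import HarnessLib

/-!
# Base change of the étale chart of the normalised quaternionic quartic cover (programme «M1», brick M1-0b)

Layer `Literature/AlgebraicGeometry/HodgeTheory`. Definitions + proved API (no named fact). Written by the prover
seat `hodge-nonav-prover-Bx` (g19, cell `hodge-nonav`), programme M1 (memo `PROGRAMME-M1-Bx-g19.md`) for route
`HodgeConjecture/Q8SymplecticPowers` (crux K1Q, stmt-HodgeConjecture-24190). Sequel of
`QuaternionicQuarticDeckChart{,Action}`.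

The chart ring is defined by UNIVERSAL relations, so it commutes with any change of coefficients `f : R → S`:
`map f (rel a k) = rel (f ∘ a) k` (`map_rel`), `(deckIdeal a).map (map f) = deckIdeal (f ∘ a)` (`deckIdeal_map`),
hence (the tree's `Resolution.polyQuotientBaseChangeEquiv`, EGA I 4.3)

  `deckRingBaseChangeEquiv : DeckRing a ⊗[R] S ≃ₐ[R] DeckRing (algebraMap R S ∘ a)`,

and on schemes (Mathlib `pullbackSpecIso`) the fibre product `deckChart a ×_{Spec R} Spec S` — the object
`deckChart a ⊗ specOver R S` of the cartesian monoidal category `SchemeOver R` — is `Spec (DeckRing (algebraMap R S ∘ a))`: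

  `deckChartTensorLeftIso : (deckChart a ⊗ specOver R S).left ≅ Spec (DeckRing (algebraMap R S ∘ a))`.

Use (bricks M1-4/M1-5): with `R = A = ℂ[a]`, `S = K = Frac A` this identifies the GENERIC FIBRE of the universal chart
with the chart of the generic coefficient vector, whose ring is a regular domain
(`QuaternionicQuarticDeckChartEtaleEquiv`, `…Integral`); with `S = ℂ` at a complex point it identifies the fibres.
Honest scope: explicit commutative algebra for one family of surfaces; nothing here bears on HC.

## References

* [EGAI] A. Grothendieck, J. Dieudonné, EGA I (1960/1971), (4.3) (base change of affine schemes) — cited through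
  [GortzWedhorn2020] U. Görtz, T. Wedhorn, Algebraic Geometry I, Prop. 4.18 / (4.11).
* [Kollar2007] J. Kollár, Lectures on Resolution of Singularities (2007), §3.3.
-/

noncomputable section

open MvPolynomial CategoryTheory AlgebraicGeometry MonoidalCategory

namespace Literature.AlgebraicGeometry.HodgeTheory.Q8Family

universe v

/-! ### The relations under a change of coefficients -/

section Map

variable {R : Type v} [CommRing R] {S : Type v} [CommRing S] {e : ℕ} (a : CIdx e → R) (f : R →+* S)

/-- `dehom` commutes with a change of coefficients. [cite: GortzWedhorn2020, Prop. 4.18] -/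
theorem dehom_map (p : MvPolynomial (Fin 3) R) : dehom (map f p) = map f (dehom p) := by
  have key : ((dehom (R := S) : MvPolynomial (Fin 3) S →+* MvPolynomial (Fin 6) S)).comp (map f) =
      (map f).comp (dehom (R := R) : MvPolynomial (Fin 3) R →+* MvPolynomial (Fin 6) R) := by
    refine MvPolynomial.ringHom_ext (fun r => ?_) (fun i => ?_)
    · simp [dehom]
    · fin_cases i <;> simp [dehom]
  exact DFunLike.congr_fun key p

/-- `map f cU = cU (f ∘ a)`. [cite: GortzWedhorn2020, Prop. 4.18] -/
@[simp] theorem map_cU : map f (cU a) = cU (f ∘ a) := by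
  rw [cU, cU, ← dehom_map, map_cOfR]

/-- `map f cU' = cU' (f ∘ a)`. [cite: GortzWedhorn2020, Prop. 4.18] -/
@[simp] theorem map_cU' : map f (cU' a) = cU' (f ∘ a) := by
  rw [cU', cU', ← dehom_map, map_rename, map_cOfR]

/-- `map f αU = αU`. [cite: GortzWedhorn2020, Prop. 4.18] -/
@[simp] theorem map_αU : map f (αU : MvPolynomial (Fin 6) R) = αU := by
  simp [αU]

/-- `map f ψU = ψU (f ∘ a)`. [cite: GortzWedhorn2020, Prop. 4.18] -/
@[simp] theorem map_ψU : map f (ψU a) = ψU (f ∘ a) := by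
  rw [ψU, ψU, ← dehom_map, map_ψOfR]

/-- `map f hU = hU (f ∘ a)`. [cite: GortzWedhorn2020, Prop. 4.18] -/
@[simp] theorem map_hU : map f (hU a) = hU (f ∘ a) := by
  simp only [hU, map_mul, map_cU, map_cU', map_αU, map_ψU]

/-- **The relations are universal**: `map f (rel a k) = rel (f ∘ a) k`. [cite: GortzWedhorn2020, Prop. 4.18] -/
@[simp] theorem map_rel (k : Fin 7) : map f (rel a k) = rel (f ∘ a) k := by
  fin_cases k <;> simp [rel]

/-- **The ideal of relations extends to the ideal of relations**: `(deckIdeal a)·S[x] = deckIdeal (f ∘ a)`.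
[cite: GortzWedhorn2020, Prop. 4.18] -/
theorem deckIdeal_map : (deckIdeal a).map (map f) = deckIdeal (f ∘ a) := by
  rw [deckIdeal, deckIdeal, Ideal.map_span, ← Set.range_comp]
  congr 1
  ext p
  simp only [Set.mem_range, Function.comp_apply, map_rel]

end Map

/-! ### Base change of the chart ring and of the chart -/

section BaseChange

variable {R : Type v} [CommRing R] (S : Type v) [CommRing S] [Algebra R S] {e : ℕ} (a : CIdx e → R)

/-- **`DeckRing a ⊗_R S ≅ DeckRing (a_S)`** (`a_S = algebraMap R S ∘ a`): base change of the chart ring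
(the tree's `polyQuotientBaseChangeEquiv` and the universality of the relations). [cite: GortzWedhorn2020, Prop. 4.18] -/
def deckRingBaseChangeEquiv : TensorProduct R (DeckRing a) S ≃ₐ[R] DeckRing (algebraMap R S ∘ a) :=
  (Resolution.polyQuotientBaseChangeEquiv S (deckIdeal a)).trans
    (Ideal.quotientEquivAlgOfEq R (deckIdeal_map a (algebraMap R S)))

/-- The base-change isomorphism on `x̄ ⊗ 1`: the class of `map x`. [cite: GortzWedhorn2020, Prop. 4.18] -/
theorem deckRingBaseChangeEquiv_mk_tmul_one (p : MvPolynomial (Fin 6) R) :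
    deckRingBaseChangeEquiv S a (TensorProduct.tmul R (Ideal.Quotient.mk (deckIdeal a) p) (1 : S)) =
      Ideal.Quotient.mk (deckIdeal (algebraMap R S ∘ a)) (map (algebraMap R S) p) := by
  rw [deckRingBaseChangeEquiv, AlgEquiv.trans_apply, Resolution.polyQuotientBaseChangeEquiv_tmul, map_one, mul_one]
  rfl

/-- `e⁻¹ ∘ e = id` for the base-change isomorphism, as ring maps. [folklore] -/
private theorem bc_symm_comp :
    ((deckRingBaseChangeEquiv S a).symm : DeckRing (algebraMap R S ∘ a) →+* TensorProduct R (DeckRing a) S).comp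
        (deckRingBaseChangeEquiv S a : TensorProduct R (DeckRing a) S →+* DeckRing (algebraMap R S ∘ a)) =
      RingHom.id _ :=
  RingHom.ext fun x => (deckRingBaseChangeEquiv S a).symm_apply_apply x

/-- `e ∘ e⁻¹ = id` for the base-change isomorphism, as ring maps. [folklore] -/
private theorem bc_comp_symm :
    (deckRingBaseChangeEquiv S a : TensorProduct R (DeckRing a) S →+* DeckRing (algebraMap R S ∘ a)).comp
        ((deckRingBaseChangeEquiv S a).symm : DeckRing (algebraMap R S ∘ a) →+* TensorProduct R (DeckRing a) S) =
      RingHom.id _ :=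
  RingHom.ext fun x => (deckRingBaseChangeEquiv S a).apply_symm_apply x

/-- `Spec` of the base-change isomorphism: `Spec (DeckRing a ⊗_R S) ≅ Spec (DeckRing a_S)`.
[cite: GortzWedhorn2020, Prop. 4.18] -/
def specDeckRingBaseChangeIso :
    Spec (CommRingCat.of (TensorProduct R (DeckRing a) S)) ≅ Spec (CommRingCat.of (DeckRing (algebraMap R S ∘ a))) where
  hom := Spec.map (CommRingCat.ofHom
    ((deckRingBaseChangeEquiv S a).symm : DeckRing (algebraMap R S ∘ a) →+* TensorProduct R (DeckRing a) S))
  inv := Spec.map (CommRingCat.ofHom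
    (deckRingBaseChangeEquiv S a : TensorProduct R (DeckRing a) S →+* DeckRing (algebraMap R S ∘ a)))
  hom_inv_id := by
    rw [← Spec.map_comp, ← CommRingCat.ofHom_comp, bc_symm_comp, CommRingCat.ofHom_id, Spec.map_id]
  inv_hom_id := by
    rw [← Spec.map_comp, ← CommRingCat.ofHom_comp, bc_comp_symm, CommRingCat.ofHom_id, Spec.map_id]

variable [Algebra ℂ R]

/-- **The fibre product `deckChart a ×_{Spec R} Spec S` is `Spec (DeckRing a_S)`** (as schemes): Mathlib's
`pullbackSpecIso` followed by `Spec` of the base-change isomorphism of rings. [cite: GortzWedhorn2020, Prop. 4.18] -/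
def deckChartTensorLeftIso :
    (deckChart a ⊗ Motives.specOver R S).left ≅ Spec (CommRingCat.of (DeckRing (algebraMap R S ∘ a))) :=
  (pullbackSpecIso R (DeckRing a) S) ≪≫ specDeckRingBaseChangeIso S a

end BaseChange

end Literature.AlgebraicGeometry.HodgeTheory.Q8Family

end
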